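import Summits.BirchSwinnertonDyer.BirchSwinnertonDyer.Theorems.GenusKolyvaginAtTwoPowDvdShaCardAtTwoRTHalfTransverseIsotropic
import HarnessLib

/-!
# Route `GenusKolyvaginAtTwo`, crux L_T `PowDvdShaCardAtTwoRT` (stmt-BirchSwinnertonDyer-23242), LINE 18 stub L, bottom rung
# (index-`≥ 2` engine, deep own primes): THE DOUBLED LOCAL CUP PRODUCT OF TWO HALF-TRANSVERSE CLASSES VANISHES — PACKAGED FORMS
# ON `Δ < 0` AT `p = 2`, AND HOW HALF-TRANSVERSALITY IS RECOGNISED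

Seat `bsd-line-gk2-p3` g21 (PROVER seat 3/3, cell `bsd-f1-sign2`), `--supports 23242 --as helper`.  THEOREMS ONLY (no
definition, no named fact, no `sorry`).  Sequel (part 2) to `…RTHalfTransverseIsotropic` (this seat) and `…RTTransverseIsotropic` (g19,
I7 at `2` over `ℚ_ℓ`).  BSD is NOT proved by any of this; neither is the crux nor stub L.

WHY (LEAD memo `Cruxes/PowDvdShaCardAtTwoRT/Lines/plus-descent-lead-g16.md` §2 and §8).  In the bottom-rung engine for index-`≥ 2`
witnesses the reciprocity law is applied to `X := 2·Z` (`Z = desc c₂(nℓ′) ∈ H¹(ℚ, E^ε[4])`) against an auxiliary `y`; at a DEEP own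
prime `ℓ ∈ t` neither class is transverse — `Z_ℓ` and `y_ℓ` lie in the index-`2` subgroup `M_ℓ = H¹_tr ⊕ H¹_f[2]` («`2•z` is
transverse», equivalently «the value `[z, F]` at the Frobenius lies in `(F − 1)T + 2T`»: HALF-TRANSVERSE) — and the LEAD's §8
observes that then `⟨X_ℓ, y_ℓ⟩ = 2⟨Z_ℓ, y_ℓ⟩ = 0` «by bilinearity alone».  This file proves that statement in the `h1Eval` /
`weilContPairing` currency of I7, at the COCHAIN level and for every level `q = p^M`: if `[x, F], [y, F] ∈ (F − 1)T + p·T` then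
EVERY value of the chosen cocycles of `x`, `y` on the decomposition group lies in `(F − 1)T + p·T` (§2; tame values and the values at
the powers of `F` are handled as in I7), and `p^{M−1}·e(l + pQ, l′ + pQ′) = p^{M−1} e(l, l′) = 0` because the anti-invariant line is
isotropic (I7 §1) and `e` is killed by `q` (§1); so the `2`-cochain of `p^{M−1}·(loc x ∪ loc y)` vanishes identically (§0, §3).
At `p = 2`, `M = 2` this is `2·(loc_ℓ Z ∪ loc_ℓ y) = loc_ℓ (2Z) ∪ loc_ℓ y = 0` — the deep-own-prime term of the engine — with NO
appeal to the splitting `H¹ = H¹_f ⊕ H¹_tr`, to Tate's self-orthogonality of `H¹_f`, or to a Hilbert symbol.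

(Part 1, `…RTHalfTransverseIsotropic`: §0–§3, the general statement `p^{M−1}·(loc_v x ∪ₑ loc_v y) = 0` /
`loc_v (p^{M−1}·x) ∪ₑ loc_v y = 0` for two half-transverse classes at any level `q = p^M`.)  This file:
* §4 the packaged forms on `Δ(E) < 0` at a Gross–Kolyvagin prime of depth `M` (`p = 2`), incl. the `inv`-form = the own-prime term of
  `sum_inv_weilCupProduct_localization_eq_zero` for the pair `(2^{M−1}·x, y)`.
* §5 bridges: transverse ⟹ half-transverse; at `p = 2`, `M ≥ 2`: **`[x, F²] ∈ (F − 1)T ⟹ x` half-transverse** (the shape of the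
  LEAD's input (iii): a class whose restriction over `K` has its Frobenius value `[x, F²]` in the eigen-line — `…RTKolyvaginValuesLine` /
  `…RTEigenNorms` — is half-transverse), and `2^{M−1}·x` transverse ⟸ `x` half-transverse.
HONEST FRAMING: helper; which classes the engine feeds in (`Z = desc c₂(nℓ′)`, the auxiliary `y`) and the COUNT of the half-transverse
condition (`#M_ℓ = 8`: this seat's `…RTDoublingIsotropy` / `…RTOrderFourAuxiliaryGeneral`) are elsewhere.  BSD is NOT proved by any of this.

References: [McCallumLMS1991] §4 Prop. 4.4, §5 Lemma 5.3 and proof of Prop. 5.2 (p. 309); [GrossLMS1991] §3 (3.2)–(3.3), §7 (7.2);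
[NeukirchSchmidtWingberg2008] I §4.
-/

set_option autoImplicit false
set_option linter.dupNamespace false -- tree convention: `Summit.BirchSwinnertonDyer.BirchSwinnertonDyer.Theorems` (summit = sub-problem)

noncomputable section
open scoped Classical Pointwise
universe u v

namespace Summit.BirchSwinnertonDyer.BirchSwinnertonDyer.Theorems.GenusExact.TransverseIsotropy

open WeierstrassCurve NumberField IsDedekindDomain Field
open Literature.NumberTheory.EllipticCurves Literature.NumberTheory.GaloisRepresentations
open Literature.NumberTheory.GaloisCohomology
open Summit.BirchSwinnertonDyer.BirchSwinnertonDyer.Theorems.GenusExact.FrobeniusCriterion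

/-! ## §4 The packaged forms on `Δ(E) < 0` at a Gross–Kolyvagin prime of depth `M` (`p = 2`) -/

section Packaged

variable {v : HeightOneSpectrum (𝓞 ℚ)} (W : WeierstrassCurve ℚ) [W.IsElliptic]

/-- **The doubled own-prime term at `p = 2`, packaged.**  `E = W/ℚ` elliptic with `Δ < 0`, `q = 2^M` (`M ≥ 1`), `ℓ` an odd prime at the
good place `v` with `Frob(ℓ) = Frob(∞)` on `ℚ(E[q])` (`FrobEqFrobInfty W K q ℓ`, a Gross–Kolyvagin prime of depth `M`), `e` an
alternating biadditive `Γ_ℚ`-equivariant `μ_q`-valued pairing on `E[q]`.  If `x, y ∈ H¹(ℚ, E[q])` are HALF-TRANSVERSE AT `v` —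
`[x, F] ∈ (F − 1)E[q] + 2·E[q]` for every arithmetic Frobenius `F` at every `𝔓 ∣ v` acting on `E[q]` as a complex conjugation (quantified
like the hypothesis `hR` of `lemma_5_3_descent_of_reciprocity_rat_two`) — then **`2^{M−1}·(loc_v x ∪ₑ loc_v y) = 0` in `H²(ℚ_v, μ_q)`**.
[cite: McCallumLMS1991, §5 Lemma 5.3 and proof of Prop. 5.2] [cite: GrossLMS1991, §3 (3.2)–(3.3)] -/
theorem nsmul_cupProduct_localization_eq_zero_of_halfTransverse_of_Δ_neg (hΔ : W.Δ < 0) {M : ℕ} (hM : 1 ≤ M)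
    {ℓ : ℕ} (hℓ : ℓ.Prime) (hℓ2 : ℓ ≠ 2) (hℓv : (ℓ : 𝓞 ℚ) ∈ v.asIdeal) (hgood : W.HasGoodReductionAt v)
    {K : Type} [Field K] [NumberField K] (hℓM : FrobEqFrobInfty W K (2 ^ M) ℓ)
    (e : geomTorsion W (2 ^ M : ℕ) → geomTorsion W (2 ^ M : ℕ) → AlgebraicClosure ℚ)
    (hμ : ∀ S T, e S T ^ (2 ^ M) = 1) (hadd₁ : ∀ S₁ S₂ T, e (S₁ + S₂) T = e S₁ T * e S₂ T)
    (hadd₂ : ∀ S T₁ T₂, e S (T₁ + T₂) = e S T₁ * e S T₂) (halt : ∀ T, e T T = 1)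
    (hgal : ∀ (σ : absoluteGaloisGroup ℚ) (S T : geomTorsion W (2 ^ M : ℕ)), σ • e S T = e (σ • S) (σ • T))
    {x y : galH1Torsion W ((2 ^ M : ℕ) : ℤ)}
    (hx : ∀ 𝔓 ∈ v.primesAbove, ∀ F c₀ : absoluteGaloisGroup ℚ, IsArithFrobAt (𝓞 ℚ) F 𝔓 →
      IsComplexConjugation (Rat.castHom ℝ) c₀ → (∀ P : geomTorsion W ((2 ^ M : ℕ) : ℤ), F • P = c₀ • P) →
      ∃ P₁ Q₁ : geomTorsion W ((2 ^ M : ℕ) : ℤ), h1Eval W _ x F = (F • P₁ - P₁) + (2 : ℕ) • Q₁)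
    (hy : ∀ 𝔓 ∈ v.primesAbove, ∀ F c₀ : absoluteGaloisGroup ℚ, IsArithFrobAt (𝓞 ℚ) F 𝔓 →
      IsComplexConjugation (Rat.castHom ℝ) c₀ → (∀ P : geomTorsion W ((2 ^ M : ℕ) : ℤ), F • P = c₀ • P) →
      ∃ P₂ Q₂ : geomTorsion W ((2 ^ M : ℕ) : ℤ), h1Eval W _ y F = (F • P₂ - P₂) + (2 : ℕ) • Q₂) :
    haveI := absoluteGaloisGroup_compactSpace (v.adicCompletion ℚ)
    2 ^ (M - 1) • ((weilContPairing W (2 ^ M) e hμ hadd₁ hadd₂ hgal).restrict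
      (absGaloisRestrict ℚ (v.adicCompletion ℚ))).cupProduct
        (galoisCohomology.localization (W.torsionGaloisModule ((2 ^ M : ℕ) : ℤ)) (Sum.inr v) 1 x)
        (galoisCohomology.localization (W.torsionGaloisModule ((2 ^ M : ℕ) : ℤ)) (Sum.inr v) 1 y) = 0 := by
  have h2v : ((2 : ℕ) : 𝓞 ℚ) ∉ v.asIdeal := two_notMem_of_odd_prime_mem hℓ hℓ2 hℓv
  have hqv' : ((2 ^ M : ℕ) : 𝓞 ℚ) ∉ v.asIdeal := by
    rw [Nat.cast_pow]
    exact fun h ↦ h2v (v.isPrime.mem_of_pow_mem M h)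
  have hqv : ((((2 ^ M : ℕ) : ℤ)) : 𝓞 ℚ) ∉ v.asIdeal := by rwa [Int.cast_natCast]
  have hq0 : (2 ^ M : ℕ) ≠ 0 := pow_ne_zero M two_ne_zero
  have hq0Z : ((2 ^ M : ℕ) : ℤ) ≠ 0 := by exact_mod_cast hq0
  have hwbad : v ∉ W.badPlaces (𝓞 ℚ) := fun h ↦ h hgood
  obtain ⟨𝔐, h𝔐⟩ := v.localPrimesAbove_nonempty
  set 𝔓 := v.primeBelow (closureEmb (K := ℚ) (v.adicCompletion ℚ)) 𝔐 with h𝔓def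
  have h𝔓 : 𝔓 ∈ v.primesAbove := HeightOneSpectrum.primeBelow_mem_primesAbove h𝔐
  haveI : 𝔓.IsPrime := h𝔓.1
  obtain ⟨F, c₀, hFrob, hc₀, hE, -⟩ := FrobEqFrobInfty.exists_at (W := W) (K := K) hℓ hℓM hℓv h𝔓
  obtain ⟨P, hPM, hgen, hfree⟩ := exists_regular_generator_of_Δ_neg W hΔ hc₀ hM
  have hgenF : ∀ Q : geomTorsion W ((2 ^ M : ℕ) : ℤ), ∃ x y : ℤ, Q = x • P + y • F • P := by
    intro Q; rw [hE P]; exact hgen Q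
  have hfreeF : ∀ x y : ℤ, x • P + y • F • P = 0 → ((2 ^ M : ℕ) : ℤ) ∣ x ∧ ((2 ^ M : ℕ) : ℤ) ∣ y := by
    intro x y h; rw [hE P] at h; exact_mod_cast hfree x y h
  have hPq : ((2 ^ M : ℕ) : ℤ) • P = 0 := by exact_mod_cast hPM
  have hF : ∀ Q : geomTorsion W ((2 ^ M : ℕ) : ℤ), F • F • Q = Q := fun Q ↦ by
    rw [hE, hE, ← mul_smul, ← pow_two, hc₀.sq_eq_one, one_smul]
  have hI : 𝔓.inertia (absoluteGaloisGroup ℚ) ≤ torsionFixing W ((2 ^ M : ℕ) : ℤ) :=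
    inertia_le_torsionFixing W hwbad hqv _ h𝔐
  have hopen := isOpen_torsionFixing W hq0Z
  have hFμ : ∀ ζ : AlgebraicClosure ℚ, ζ ^ (2 ^ M) = 1 → F • ζ = ζ⁻¹ := fun ζ hζ ↦
    smul_eq_inv_of_smul_torsion_pow_eq W Nat.prime_two hM rfl hc₀ hE hζ
  exact nsmul_cupProduct_localization_eq_zero_of_halfTransverse W Nat.prime_two rfl hM hqv' h𝔐 hFrob hFμ hF hPq hgenF
    hfreeF hI hopen e hμ hadd₁ hadd₂ halt hgal (hx 𝔓 h𝔓 F c₀ hFrob hc₀ hE) (hy 𝔓 h𝔓 F c₀ hFrob hc₀ hE)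

/-- **The `ℓ`-term of the Poitou–Tate sum vanishes for the pair `(2^{M−1}·x, y)` of half-transverse classes** (same setting): for every
family of local invariant maps `inv` (`LocalInvariants`), `inv_v (loc_v (2^{M−1}·x) ∪_{e,v} loc_v y) = 0` — the shape of the term at a
DEEP own prime `ℓ ∈ t` of `sum_inv_weilCupProduct_localization_eq_zero` in the LEAD's engine (`X = 2Z` at `M = 2`).
[cite: McCallumLMS1991, §5, proof of Prop. 5.2 (13)] -/
theorem inv_cupProduct_localization_nsmul_eq_zero_of_halfTransverse_of_Δ_neg (hΔ : W.Δ < 0) {M : ℕ} (hM : 1 ≤ M)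
    {ℓ : ℕ} (hℓ : ℓ.Prime) (hℓ2 : ℓ ≠ 2) (hℓv : (ℓ : 𝓞 ℚ) ∈ v.asIdeal) (hgood : W.HasGoodReductionAt v)
    {K : Type} [Field K] [NumberField K] (hℓM : FrobEqFrobInfty W K (2 ^ M) ℓ)
    (e : geomTorsion W (2 ^ M : ℕ) → geomTorsion W (2 ^ M : ℕ) → AlgebraicClosure ℚ)
    (hμ : ∀ S T, e S T ^ (2 ^ M) = 1) (hadd₁ : ∀ S₁ S₂ T, e (S₁ + S₂) T = e S₁ T * e S₂ T)
    (hadd₂ : ∀ S T₁ T₂, e S (T₁ + T₂) = e S T₁ * e S T₂) (halt : ∀ T, e T T = 1)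
    (hgal : ∀ (σ : absoluteGaloisGroup ℚ) (S T : geomTorsion W (2 ^ M : ℕ)), σ • e S T = e (σ • S) (σ • T))
    (inv : LocalInvariants ℚ (2 ^ M))
    {x y : galH1Torsion W ((2 ^ M : ℕ) : ℤ)}
    (hx : ∀ 𝔓 ∈ v.primesAbove, ∀ F c₀ : absoluteGaloisGroup ℚ, IsArithFrobAt (𝓞 ℚ) F 𝔓 →
      IsComplexConjugation (Rat.castHom ℝ) c₀ → (∀ P : geomTorsion W ((2 ^ M : ℕ) : ℤ), F • P = c₀ • P) →
      ∃ P₁ Q₁ : geomTorsion W ((2 ^ M : ℕ) : ℤ), h1Eval W _ x F = (F • P₁ - P₁) + (2 : ℕ) • Q₁)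
    (hy : ∀ 𝔓 ∈ v.primesAbove, ∀ F c₀ : absoluteGaloisGroup ℚ, IsArithFrobAt (𝓞 ℚ) F 𝔓 →
      IsComplexConjugation (Rat.castHom ℝ) c₀ → (∀ P : geomTorsion W ((2 ^ M : ℕ) : ℤ), F • P = c₀ • P) →
      ∃ P₂ Q₂ : geomTorsion W ((2 ^ M : ℕ) : ℤ), h1Eval W _ y F = (F • P₂ - P₂) + (2 : ℕ) • Q₂) :
    haveI := absoluteGaloisGroup_compactSpace (Place.Completion (Sum.inr v : Place ℚ))
    inv (Sum.inr v) ((weilContPairingLocal W (2 ^ M) e hμ hadd₁ hadd₂ hgal (Sum.inr v)).cupProduct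
      (galoisCohomology.localization (W.torsionGaloisModule ((2 ^ M : ℕ) : ℤ)) (Sum.inr v) 1 ((2 ^ (M - 1) : ℕ) • x))
      (galoisCohomology.localization (W.torsionGaloisModule ((2 ^ M : ℕ) : ℤ)) (Sum.inr v) 1 y)) = 0 := by
  haveI := absoluteGaloisGroup_compactSpace (Place.Completion (Sum.inr v : Place ℚ))
  have h := nsmul_cupProduct_localization_eq_zero_of_halfTransverse_of_Δ_neg W hΔ hM hℓ hℓ2 hℓv hgood hℓM e hμ hadd₁ hadd₂
    halt hgal hx hy
  have h' : (weilContPairingLocal W (2 ^ M) e hμ hadd₁ hadd₂ hgal (Sum.inr v)).cupProduct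
      (galoisCohomology.localization (W.torsionGaloisModule ((2 ^ M : ℕ) : ℤ)) (Sum.inr v) 1 ((2 ^ (M - 1) : ℕ) • x))
      (galoisCohomology.localization (W.torsionGaloisModule ((2 ^ M : ℕ) : ℤ)) (Sum.inr v) 1 y) = 0 := by
    rw [show galoisCohomology.localization (W.torsionGaloisModule ((2 ^ M : ℕ) : ℤ)) (Sum.inr v) 1 ((2 ^ (M - 1) : ℕ) • x) =
        (2 ^ (M - 1) : ℕ) • galoisCohomology.localization (W.torsionGaloisModule ((2 ^ M : ℕ) : ℤ)) (Sum.inr v) 1 x from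
      map_nsmul _ _ _]
    erw [map_nsmul, LinearMap.smul_apply]
    exact h
  rw [h']
  exact map_zero _

end Packaged

/-! ## §5 Bridges: how half-transversality is recognised -/

section Bridges

variable {K : Type u} [Field K] (W : WeierstrassCurve K) {n : ℤ} {F : absoluteGaloisGroup K} {M : ℕ}
  {P : geomTorsion W n}

/-- A transverse class is half-transverse (`Q₁ = 0`). [folklore] -/
theorem halfTransverse_of_transverse {p : ℕ} {x : galH1Torsion W n}
    (hx : ∃ P₁ : geomTorsion W n, h1Eval W n x F = F • P₁ - P₁) :
    ∃ P₁ Q₁ : geomTorsion W n, h1Eval W n x F = (F • P₁ - P₁) + p • Q₁ := by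
  obtain ⟨P₁, hP₁⟩ := hx
  exact ⟨P₁, 0, by rw [hP₁, smul_zero, add_zero]⟩

/-- **Norm-line criterion at `p = 2`** (`M ≥ 2`): for `T = E[n]` free of rank one over `ℤ/2^M[F]` on `P`, if the NORM of `[x, F]` lies
in the anti-invariant line — `[x, F] + F[x, F] = FP₂ − P₂` — then `x` is HALF-TRANSVERSE: writing `[x, F] = aP + bFP`, the norm is
`(a+b)(P + FP)`, and `(a+b)(P+FP) ∈ ℤ(FP − P)` forces `2^M ∣ 2(a+b)`, so `a + b` is even and `[x,F] = (a+b)P + b(FP − P) ∈ 2T + (F−1)T`.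
[cite: McCallumLMS1991, §4 Prop. 4.4 (1)] -/
theorem halfTransverse_of_norm_h1Eval_mem_line (hM : 2 ≤ M) (hPM : (2 : ℤ) ^ M • P = 0)
    (hgen : ∀ Q : geomTorsion W n, ∃ x y : ℤ, Q = x • P + y • F • P)
    (hfree : ∀ x y : ℤ, x • P + y • F • P = 0 → (2 : ℤ) ^ M ∣ x ∧ (2 : ℤ) ^ M ∣ y)
    (hF : ∀ Q : geomTorsion W n, F • F • Q = Q)
    {x : galH1Torsion W n} (hN : ∃ P₂ : geomTorsion W n, h1Eval W n x F + F • h1Eval W n x F = F • P₂ - P₂) :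
    ∃ P₁ Q₁ : geomTorsion W n, h1Eval W n x F = (F • P₁ - P₁) + (2 : ℕ) • Q₁ := by
  obtain ⟨P₂, hP₂⟩ := hN
  obtain ⟨a, b, hab⟩ := hgen (h1Eval W n x F)
  obtain ⟨c, d, hcd⟩ := hgen P₂
  -- the norm is `(a + b)(P + FP)`; `FP₂ − P₂ = (d - c) P + (c - d) FP`
  have hnorm : h1Eval W n x F + F • h1Eval W n x F = (a + b) • P + (a + b) • F • P := by
    rw [hab, smul_add, smul_comm F a P, smul_comm F b (F • P), hF, add_smul, add_smul]
    abel
  have hrhs : F • P₂ - P₂ = (d - c) • P + (c - d) • F • P := by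
    rw [hcd, smul_add, smul_comm F c P, smul_comm F d (F • P), hF, sub_smul, sub_smul]
    abel
  have hzero : (a + b - (d - c)) • P + (a + b - (c - d)) • F • P = 0 := by
    have h := hP₂
    rw [hnorm, hrhs] at h
    rw [sub_smul (a + b) (d - c) P, sub_smul (a + b) (c - d) (F • P), sub_add_sub_comm, h, sub_self]
  obtain ⟨⟨k₁, hk₁⟩, ⟨k₂, hk₂⟩⟩ := hfree _ _ hzero
  -- `2^M ∣ 2(a+b)`, so `2 ∣ a + b` (as `M ≥ 2`; indeed `2^{M-1} ∣ a + b`)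
  have h2ab : (2 : ℤ) ∣ a + b := by
    have hsum : 2 * (a + b) = 2 ^ M * (k₁ + k₂) := by linear_combination hk₁ + hk₂
    obtain ⟨M', rfl⟩ : ∃ M', M = M' + 2 := ⟨M - 2, by omega⟩
    refine ⟨2 ^ M' * (k₁ + k₂), ?_⟩
    have : 2 * (a + b) = 2 * (2 * (2 ^ M' * (k₁ + k₂))) := by rw [hsum]; ring
    linarith
  obtain ⟨m, hm⟩ := h2ab
  refine ⟨b • P, m • P, ?_⟩
  have h2m : (2 : ℕ) • (m • P) = (a + b) • P := by rw [hm, two_mul, add_smul, two_nsmul]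
  rw [hab, smul_comm F b P, h2m, add_smul]
  abel

/-- **Square criterion at `p = 2`** (`M ≥ 2`): `[x, F²] = [x, F] + F[x, F]`, so **`[x, F²] ∈ (F − 1)T ⟹ x` half-transverse**.  This
is the shape in which the LEAD's input (iii) arrives: a class `x ∈ H¹(ℚ, E^ε[2^M])` whose restriction over `K` (where `F² ∈ Γ_K` is a
Frobenius at `λ`) has its Frobenius value in the eigen-line (`…RTKolyvaginValuesLine`, `…RTEigenNorms`) is half-transverse at `ℓ`.
[cite: McCallumLMS1991, §4 Prop. 4.4 (1), §5 proof of Prop. 5.2] -/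
theorem halfTransverse_of_h1Eval_sq_mem_line (hM : 2 ≤ M) (hPM : (2 : ℤ) ^ M • P = 0)
    (hgen : ∀ Q : geomTorsion W n, ∃ x y : ℤ, Q = x • P + y • F • P)
    (hfree : ∀ x y : ℤ, x • P + y • F • P = 0 → (2 : ℤ) ^ M ∣ x ∧ (2 : ℤ) ^ M ∣ y)
    (hF : ∀ Q : geomTorsion W n, F • F • Q = Q)
    {x : galH1Torsion W n} (h2 : ∃ P₂ : geomTorsion W n, h1Eval W n x (F * F) = F • P₂ - P₂) :
    ∃ P₁ Q₁ : geomTorsion W n, h1Eval W n x F = (F • P₁ - P₁) + (2 : ℕ) • Q₁ := by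
  rw [h1Eval_mul_smul] at h2
  exact halfTransverse_of_norm_h1Eval_mem_line W hM hPM hgen hfree hF h2

/-- **`2^{M−1}·`(half-transverse) is transverse at the level of VALUES**: if `[x, F] = (FP₁ − P₁) + 2Q₁` and `2^M·T = 0`, then
`2^{M−1}·[x, F] = F(2^{M−1}P₁) − 2^{M−1}P₁ ∈ (F − 1)T`.  (On classes, `[2^{M−1}x, F]` differs from `2^{M−1}[x, F]` by a coboundary
value `FR − R`, which lies in the line as well: `exists_h1Eval_zsmul_eq`.) [folklore] -/
theorem exists_nsmul_h1Eval_eq_smul_sub_of_halfTransverse (hM : 1 ≤ M)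
    (hT : ∀ Q : geomTorsion W n, (2 : ℤ) ^ M • Q = 0) {x : galH1Torsion W n}
    (hx : ∃ P₁ Q₁ : geomTorsion W n, h1Eval W n x F = (F • P₁ - P₁) + (2 : ℕ) • Q₁) :
    ∃ P₃ : geomTorsion W n, ((2 ^ (M - 1) : ℕ) : ℤ) • h1Eval W n x F = F • P₃ - P₃ := by
  obtain ⟨P₁, Q₁, hP₁⟩ := hx
  refine ⟨((2 ^ (M - 1) : ℕ) : ℤ) • P₁, ?_⟩
  have h2Q : ((2 ^ (M - 1) : ℕ) : ℤ) • ((2 : ℕ) • Q₁) = 0 := by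
    rw [← natCast_zsmul, smul_smul, ← Nat.cast_mul, ← pow_succ, Nat.sub_add_cancel hM, Nat.cast_pow, Nat.cast_ofNat, hT]
  rw [hP₁, smul_add, h2Q, add_zero, smul_sub, smul_comm]

/-- **`2^{M−1}·x` is TRANSVERSE when `x` is half-transverse** (on classes: combine the value computation with the coboundary
correction `[c•x, F] = c[x, F] + (FR − R)` of `exists_h1Eval_zsmul_eq`). [folklore] -/
theorem transverse_nsmul_of_halfTransverse (hM : 1 ≤ M)
    (hT : ∀ Q : geomTorsion W n, (2 : ℤ) ^ M • Q = 0) {x : galH1Torsion W n}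
    (hx : ∃ P₁ Q₁ : geomTorsion W n, h1Eval W n x F = (F • P₁ - P₁) + (2 : ℕ) • Q₁) :
    ∃ P₃ : geomTorsion W n, h1Eval W n (((2 ^ (M - 1) : ℕ) : ℤ) • x) F = F • P₃ - P₃ := by
  obtain ⟨P₃, hP₃⟩ := exists_nsmul_h1Eval_eq_smul_sub_of_halfTransverse W hM hT hx
  obtain ⟨R, hR⟩ := exists_h1Eval_zsmul_eq W n x ((2 ^ (M - 1) : ℕ) : ℤ) F
  refine ⟨P₃ + R, ?_⟩
  rw [hR, hP₃, smul_add]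
  abel

end Bridges

end Summit.BirchSwinnertonDyer.BirchSwinnertonDyer.Theorems.GenusExact.TransverseIsotropy

end
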